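import Literature.Barriers.SmoothPoincare4.ExoticOpenFourSpace
import Mathlib.MeasureTheory.Function.JacobianOneDim
import Mathlib.Analysis.SpecialFunctions.Pow.Continuity
import Mathlib.Analysis.SpecialFunctions.Pow.Real
import HarnessLib

/-!
# `deMichelisFreedman1992_continuum`: Appendix B's closing "elementary argument" — any combination of the two decay alternatives is exponential decay

Proof file (theorems only) in the cone of the named fact
`Literature.Barriers.SmoothPoincare4.deMichelisFreedman1992_continuum` (DeMichelis–Freedman
1992, Thm. 4.1 with Cor. 4.1: continuum many pairwise non-diffeomorphic open subsets of standard
`ℝ⁴`, each homeomorphic to `ℝ⁴`; `ExoticOpenFourSpace.lean`). Its siblings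
(`ExoticOpenFourSpace{Proofs, EmbeddingProofs, PolarProofs, PolarNhdProofs, EndPeriodicProofs}`)
formalize the elementary topology of §0, §2 and §4; what they leave is the gauge theory: the
`Φ`-invariant (§1) and Thm. 2.1 "`Φ` commutes with geometric limit" with its Appendices A and B
("Appendices A and B supply two important analytical details needed to complete the arguments of
§2", p. 221). THIS FILE proves the one step of that analysis which the source leaves to the
reader — the last paragraph of Appendix B (p. 253).

Appendix B ("`L²` implies `L²_δ`", pp. 251–253) shows that the energy `I_t = ∫_{τ > t} |F_A|²`
of a finite-energy ASD connection on an end of bounded geometry decays exponentially in the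
height `τ` (used in Point 1 of the proof of Thm. 2.1, p. 225). Its estimates (B.1)–(B.8)
(Chern–Simons, first eigenvalue of `curl`, the "far from critical" set `ℝ₊ ∖ Δ` where "the
measure of `Δ` intersected with any interval of length one is smaller than `½`", p. 251) end in
the dichotomy (B.8), and the source concludes (p. 253): "Since `I_t` is strictly decreasing,
(B.8) implies that on a set `ℝ₊ ∖ Δ` of density `> ½` either the rate of decrease is `> C₁ I_t`
or `C₄ (I_N - I_{N+1})^{3/2} > ½ I_{N+1}`. An elementary argument shows that any combination of
these two alternatives on `ℝ₊ ∖ Δ` gives at least exponential decay, hence (B.9)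
`I_t < C₅ e^{-τδ}` for some `δ`." The elementary argument, for an antitone nonnegative
`I : ℝ → ℝ` (namespace `EnergyDecay`):
* `mul_volume_mul_le_sub_of_deriv_le` — alternative 1 on one unit interval: if `I' ≤ -c I` on a
  measurable `S ⊆ [a, b]` where `I` is differentiable, then `c |S| I b ≤ I a - I b` (Lebesgue's
  theorem for monotone functions in Mathlib's change-of-variables form
  `lintegral_deriv_eq_volume_image_of_antitoneOn`: `∫_S (-I') = |I(S)| ≤ I a - I b`); with
  `|S| ≥ ½` (`half_le_toReal_volume_Ico_diff`) this is the geometric step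
  `I (N+1) ≤ (1 + C₁/2)⁻¹ I N`;
* `exists_forall_le_half_of_le_rpow` — alternative 2, `I (N+1) ≤ C (I N - I (N+1))^p` with
  `p > 1` (`p = 3/2` in the source), forces `I (N+1) ≤ ½ I N` from some `N₁` on, because the
  differences of the convergent sequence `I N` tend to `0`;
* `le_mul_pow_of_succ_le_mul`, `le_mul_pow_of_succ_le_mul'`, `exists_exp_bound_of_succ_le_mul` —
  a geometric step of the integer samples from a threshold on is an exponential bound
  `I t ≤ C₅ e^{-δt}`, `t ≥ 0`, for an antitone nonnegative `I`;
* `deMichelisFreedman1992_appendixB_exp_decay` — (B.8) ⟹ (B.9) with the alternatives per unit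
  interval, and `deMichelisFreedman1992_appendixB_exp_decay_pointwise` — with the alternatives
  pointwise on `ℝ₊ ∖ Δ` as printed (both in the directory namespace; the lemmas above in the
  sub-namespace `EnergyDecay`).

NOT rendered: (B.1)–(B.8) themselves and the statement of Appendix B (connections, curvature,
Chern–Simons), nor anything else of Thm. 2.1; no named fact is introduced (D-0026).

## References

* S. DeMichelis, M. H. Freedman, *Uncountably many exotic `R⁴`'s in standard 4-space*,
  J. Differential Geom. 35 (1992) 219–254: §2, Thm. 2.1 and Point 1 (pp. 224–225); Appendix B
  (pp. 251–253), (B.8)–(B.9) (p. 253) [DeMichelisFreedman1992].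

[DeMichelisFreedman1992]
-/

noncomputable section

open MeasureTheory Set Filter Topology
open scoped ENNReal

namespace Literature.Barriers.SmoothPoincare4

namespace EnergyDecay

/-! #### Geometric decay of a sequence from a threshold on gives an exponential bound -/

/-- If `a (n+1) ≤ θ · a n` for `n ≥ M` (`0 ≤ θ`), then `a n ≤ a M · θ^(n - M)` for `n ≥ M`.
[folklore] -/
theorem le_mul_pow_of_succ_le_mul {a : ℕ → ℝ} {θ : ℝ} (hθ0 : 0 ≤ θ) {M : ℕ}
    (h : ∀ n, M ≤ n → a (n + 1) ≤ θ * a n) :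
    ∀ n, M ≤ n → a n ≤ a M * θ ^ (n - M) := by
  intro n hn
  obtain ⟨k, rfl⟩ := Nat.exists_eq_add_of_le hn
  clear hn
  induction k with
  | zero => simp
  | succ k ih =>
    calc a (M + (k + 1)) = a (M + k + 1) := by rw [add_assoc]
      _ ≤ θ * a (M + k) := h _ (Nat.le_add_right M k)
      _ ≤ θ * (a M * θ ^ (M + k - M)) := mul_le_mul_of_nonneg_left ih hθ0
      _ = a M * θ ^ (M + (k + 1) - M) := by
        rw [Nat.add_sub_cancel_left, Nat.add_sub_cancel_left, pow_succ]
        ring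

/-- A nonnegative antitone sequence with `a (n+1) ≤ θ · a n` for `n ≥ M`, `0 < θ ≤ 1`, satisfies
`a n ≤ (a 0 · θ⁻¹ ^ M) · θ ^ n` for ALL `n`. [folklore] -/
theorem le_mul_pow_of_succ_le_mul' {a : ℕ → ℝ} (ha : Antitone a) (ha0 : ∀ n, 0 ≤ a n) {θ : ℝ}
    (hθ0 : 0 < θ) (hθ1 : θ ≤ 1) {M : ℕ} (h : ∀ n, M ≤ n → a (n + 1) ≤ θ * a n) (n : ℕ) :
    a n ≤ a 0 * θ⁻¹ ^ M * θ ^ n := by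
  have hθinv : 1 ≤ θ⁻¹ := one_le_inv_iff₀.2 ⟨hθ0, hθ1⟩
  rcases le_or_gt M n with hMn | hnM
  · calc a n ≤ a M * θ ^ (n - M) := le_mul_pow_of_succ_le_mul hθ0.le h n hMn
      _ ≤ a 0 * θ ^ (n - M) := by
        gcongr
        exact ha (Nat.zero_le M)
      _ = a 0 * θ⁻¹ ^ M * θ ^ n := by
        obtain ⟨k, rfl⟩ := Nat.exists_eq_add_of_le hMn
        rw [Nat.add_sub_cancel_left, pow_add, mul_assoc, ← mul_assoc (θ⁻¹ ^ M), ← mul_pow,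
          inv_mul_cancel₀ hθ0.ne', one_pow, one_mul]
  · calc a n ≤ a 0 := ha (Nat.zero_le n)
      _ = a 0 * θ⁻¹ ^ n * θ ^ n := by
        rw [mul_assoc, ← mul_pow, inv_mul_cancel₀ hθ0.ne', one_pow, mul_one]
      _ ≤ a 0 * θ⁻¹ ^ M * θ ^ n := by
        apply mul_le_mul_of_nonneg_right _ (pow_nonneg hθ0.le n)
        exact mul_le_mul_of_nonneg_left (pow_le_pow_right₀ hθinv hnM.le) (ha0 0)

/-- **Exponential decay in continuous time from a geometric step of the integer samples.** Let
`I : ℝ → ℝ` be antitone and nonnegative and suppose `I (n + 1) ≤ θ · I n` for all integers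
`n ≥ M`, with `0 < θ < 1`. Then `I t ≤ C₅ · exp (-δ t)` for all `t ≥ 0`, with `δ = -log θ > 0`.
[folklore] -/
theorem exists_exp_bound_of_succ_le_mul {I : ℝ → ℝ} (hI : Antitone I) (hI0 : ∀ t, 0 ≤ I t)
    {θ : ℝ} (hθ0 : 0 < θ) (hθ1 : θ < 1) {M : ℕ}
    (h : ∀ n : ℕ, M ≤ n → I (n + 1) ≤ θ * I n) :
    ∃ C₅ δ : ℝ, 0 < δ ∧ 0 ≤ C₅ ∧ ∀ t, 0 ≤ t → I t ≤ C₅ * Real.exp (-(δ * t)) := by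
  set a : ℕ → ℝ := fun n => I n with ha_def
  have ha : Antitone a := fun m n hmn => hI (by exact_mod_cast hmn)
  have ha0 : ∀ n, 0 ≤ a n := fun n => hI0 n
  have hstep : ∀ n, M ≤ n → a (n + 1) ≤ θ * a n := fun n hn => by
    simp only [ha_def, Nat.cast_add, Nat.cast_one]
    exact h n hn
  have hbound := le_mul_pow_of_succ_le_mul' ha ha0 hθ0 hθ1.le hstep
  set K : ℝ := a 0 * θ⁻¹ ^ M with hK
  have hK0 : 0 ≤ K := mul_nonneg (ha0 0) (pow_nonneg (inv_nonneg.2 hθ0.le) M)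
  have hlog : Real.log θ < 0 := Real.log_neg hθ0 hθ1
  refine ⟨K * θ⁻¹, -Real.log θ, neg_pos.2 hlog, mul_nonneg hK0 (inv_nonneg.2 hθ0.le),
    fun t ht => ?_⟩
  have hn : (⌊t⌋₊ : ℝ) ≤ t := Nat.floor_le ht
  have hn' : t < ⌊t⌋₊ + 1 := Nat.lt_floor_add_one t
  calc I t ≤ I ⌊t⌋₊ := hI hn
    _ ≤ K * θ ^ ⌊t⌋₊ := hbound ⌊t⌋₊
    _ = K * Real.exp (⌊t⌋₊ * Real.log θ) := by rw [Real.exp_nat_mul, Real.exp_log hθ0]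
    _ ≤ K * Real.exp ((t - 1) * Real.log θ) := by
        gcongr K * Real.exp ?_
        nlinarith
    _ = K * θ⁻¹ * Real.exp (-(-Real.log θ * t)) := by
        rw [sub_mul, one_mul, Real.exp_sub, Real.exp_log hθ0, neg_mul, neg_neg, mul_comm t]
        field_simp

/-! #### The second alternative eventually gives a geometric step -/

/-- **Alternative 2 of (B.8)** ("`C₄ (I_N - I_{N+1})^{3/2} > ½ I_{N+1}`", i.e.
`I (N+1) ≤ C (I N - I (N+1))^p` with `p = 3/2 > 1`): since the differences of a convergent
(antitone, bounded below) sequence tend to `0`, from some `N₁` on this alternative forces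
`I (N+1) ≤ ½ I N`. [cite: DeMichelisFreedman1992, App. B, (B.8)–(B.9) (p. 253)] -/
theorem exists_forall_le_half_of_le_rpow {a : ℕ → ℝ} (ha : Antitone a) (ha0 : ∀ n, 0 ≤ a n)
    {C p : ℝ} (hp : 1 < p) :
    ∃ N₁ : ℕ, ∀ n, N₁ ≤ n → a (n + 1) ≤ C * (a n - a (n + 1)) ^ p →
      a (n + 1) ≤ 2⁻¹ * a n := by
  -- the differences tend to zero
  have hconv : Tendsto a atTop (𝓝 (⨅ n, a n)) :=
    tendsto_atTop_ciInf ha ⟨0, by rintro _ ⟨n, rfl⟩; exact ha0 n⟩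
  have hdiff : Tendsto (fun n => a n - a (n + 1)) atTop (𝓝 0) := by
    have := hconv.sub (hconv.comp (tendsto_add_atTop_nat 1))
    simpa using this
  have hpow : Tendsto (fun n => C * (a n - a (n + 1)) ^ (p - 1)) atTop (𝓝 0) := by
    have h1 := hdiff.rpow_const (p := p - 1) (Or.inr (by linarith))
    rw [Real.zero_rpow (by linarith)] at h1
    simpa using h1.const_mul C
  obtain ⟨N₁, hN₁⟩ := eventually_atTop.1 ((tendsto_order.1 hpow).2 2⁻¹ (by norm_num))
  refine ⟨N₁, fun n hn hle => ?_⟩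
  have hd0 : 0 ≤ a n - a (n + 1) := sub_nonneg.2 (ha (Nat.le_succ n))
  have hsplit : C * (a n - a (n + 1)) ^ p =
      C * (a n - a (n + 1)) ^ (p - 1) * (a n - a (n + 1)) := by
    conv_lhs => rw [show p = (p - 1) + 1 by ring, Real.rpow_add' hd0 (by linarith),
      Real.rpow_one]
    ring
  have h2 : a (n + 1) ≤ 2⁻¹ * (a n - a (n + 1)) := by
    calc a (n + 1) ≤ C * (a n - a (n + 1)) ^ (p - 1) * (a n - a (n + 1)) := hsplit ▸ hle
      _ ≤ 2⁻¹ * (a n - a (n + 1)) := mul_le_mul_of_nonneg_right (hN₁ n hn).le hd0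
  linarith [ha0 (n + 1)]

/-! #### The first alternative gives a geometric step (Lebesgue's theorem for monotone functions) -/

/-- **Alternative 1 of (B.8)** ("the rate of decrease is `> C₁ I_t`" off `Δ`): if `I` is
antitone on `[a, b]` with `0 ≤ I b`, and on a measurable `S ⊆ [a, b]` it is differentiable with
`I' ≤ -c · I` (`c ≥ 0`), then `c · |S| · I b ≤ I a - I b` — by the change-of-variables /
Lebesgue differentiation inequality for monotone functions, `∫_S (-I') = |I(S)| ≤ I a - I b`.
[cite: DeMichelisFreedman1992, App. B, (B.8)–(B.9) (p. 253)] -/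
theorem mul_volume_mul_le_sub_of_deriv_le {I I' : ℝ → ℝ} {a b c : ℝ} (hab : a ≤ b)
    (hc : 0 ≤ c) {S : Set ℝ} (hSm : MeasurableSet S) (hS : S ⊆ Icc a b)
    (hI : AntitoneOn I (Icc a b)) (hIb : 0 ≤ I b) (hd : ∀ t ∈ S, HasDerivAt I (I' t) t)
    (hle : ∀ t ∈ S, I' t ≤ -(c * I t)) :
    c * (volume S).toReal * I b ≤ I a - I b := by
  have hIab : I b ≤ I a := hI (left_mem_Icc.2 hab) (right_mem_Icc.2 hab) hab
  -- Lebesgue's theorem for monotone functions: `∫⁻_S (-I') = |I(S)|`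
  have h1 : (∫⁻ x in S, ENNReal.ofReal (-I' x)) = volume (I '' S) :=
    lintegral_deriv_eq_volume_image_of_antitoneOn hSm
      (fun x hx => (hd x hx).hasDerivWithinAt) (hI.mono hS)
  -- the image lies in `[I b, I a]`
  have h2 : volume (I '' S) ≤ ENNReal.ofReal (I a - I b) := by
    rw [← Real.volume_Icc]
    refine measure_mono ?_
    rintro _ ⟨x, hx, rfl⟩
    exact ⟨hI (hS hx) (right_mem_Icc.2 hab) (hS hx).2,
      hI (left_mem_Icc.2 hab) (hS hx) (hS hx).1⟩
  -- pointwise `-I' ≥ c · I ≥ c · I b` on `S`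
  have h3 : ENNReal.ofReal (c * I b) * volume S ≤ ∫⁻ x in S, ENNReal.ofReal (-I' x) := by
    rw [← setLIntegral_const]
    refine setLIntegral_mono' hSm fun x hx => ENNReal.ofReal_le_ofReal ?_
    have hIx : I b ≤ I x := hI (hS hx) (right_mem_Icc.2 hab) (hS hx).2
    have := hle x hx
    nlinarith
  have h4 : ENNReal.ofReal (c * I b) * volume S ≤ ENNReal.ofReal (I a - I b) :=
    h3.trans (h1.le.trans h2)
  have hSfin : volume S ≠ ∞ := by
    refine (lt_of_le_of_lt (measure_mono hS) ?_).ne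
    rw [Real.volume_Icc]
    exact ENNReal.ofReal_lt_top
  rw [← ENNReal.ofReal_toReal hSfin, ← ENNReal.ofReal_mul (mul_nonneg hc hIb)] at h4
  have h5 := (ENNReal.ofReal_le_ofReal_iff (sub_nonneg.2 hIab)).1 h4
  calc c * (volume S).toReal * I b = c * I b * (volume S).toReal := by ring
    _ ≤ I a - I b := h5

/-- In a unit interval `[N, N+1)`, if `Δ` meets `[N, N+1]` in measure `≤ ½` then the complement
of `Δ` in `[N, N+1)` has measure `≥ ½` ("the measure of `Δ` intersected with any interval of
length one is smaller than `½`", App. B, p. 251). [cite: DeMichelisFreedman1992, App. B (p. 251)] -/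
theorem half_le_toReal_volume_Ico_diff {Δ : Set ℝ} (N : ℕ)
    (hΔ : volume (Δ ∩ Icc (N : ℝ) (N + 1)) ≤ 2⁻¹) :
    (2⁻¹ : ℝ) ≤ (volume (Ico (N : ℝ) (N + 1) \ Δ)).toReal := by
  have hI : volume (Ico (N : ℝ) (N + 1)) = 1 := by
    rw [Real.volume_Ico]
    simp
  have hΔ' : volume (Ico (N : ℝ) (N + 1) ∩ Δ) ≤ 2⁻¹ :=
    (measure_mono (inter_subset_inter_left _ Ico_subset_Icc_self)).trans (by rwa [inter_comm])
  have hle : (1 : ℝ≥0∞) ≤ volume (Ico (N : ℝ) (N + 1) \ Δ) + 2⁻¹ := by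
    calc (1 : ℝ≥0∞) = volume (Ico (N : ℝ) (N + 1)) := hI.symm
      _ = volume (Ico (N : ℝ) (N + 1) \ Δ ∪ Ico (N : ℝ) (N + 1) ∩ Δ) := by
          rw [sdiff_union_inter]
      _ ≤ volume (Ico (N : ℝ) (N + 1) \ Δ) + volume (Ico (N : ℝ) (N + 1) ∩ Δ) :=
          measure_union_le _ _
      _ ≤ volume (Ico (N : ℝ) (N + 1) \ Δ) + 2⁻¹ := by
          gcongr
  have hfin : volume (Ico (N : ℝ) (N + 1) \ Δ) ≠ ∞ :=
    (lt_of_le_of_lt (measure_mono sdiff_subset) (hI.le.trans_lt ENNReal.one_lt_top)).ne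
  have h2 : (2⁻¹ : ℝ≥0∞) ≤ volume (Ico (N : ℝ) (N + 1) \ Δ) := by
    rw [← ENNReal.one_sub_inv_two]
    exact tsub_le_iff_right.2 hle
  have h3 := ENNReal.toReal_mono hfin h2
  simpa using h3

end EnergyDecay

open EnergyDecay

/-! #### The elementary argument: any combination of the two alternatives decays exponentially -/

/-- **DeMichelis–Freedman 1992, Appendix B, the closing "elementary argument"** ((B.8) ⟹ (B.9),
p. 253: "Since `I_t` is strictly decreasing, (B.8) implies that on a set `ℝ₊ ∖ Δ` of density
`> ½` either the rate of decrease is `> C₁ I_t` or `C₄ (I_N - I_{N+1})^{3/2} > ½ I_{N+1}`. An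
elementary argument shows that any combination of these two alternatives on `ℝ₊ ∖ Δ` gives at
least exponential decay, hence `I_t < C₅ e^{-tδ}` for some `δ`"). Formally: let `I : ℝ → ℝ` be
antitone and nonnegative (in the source `I_t = ∫_{τ > t} |F_A|²`, the energy of an ASD connection
beyond `τ = t`), `Δ ⊆ ℝ` measurable meeting every unit interval `[N, N+1]` in measure `≤ ½`
(p. 251: "the measure of `Δ` intersected with any interval of length one is smaller than `½`"),
`C₁ > 0`, `C₄` real, `p > 1` (`p = 3/2` in the source), and suppose that for every integer
`N ≥ N₀` EITHER `I` is differentiable with `I' ≤ -C₁ I` at every point of `[N, N+1) ∖ Δ` OR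
`I (N+1) ≤ C₄ (I N - I (N+1))^p`. Then `I t ≤ C₅ e^{-δt}` for all `t ≥ 0`, for some `C₅ ≥ 0` and
`δ > 0`. Proof: the first alternative gives `I (N+1) ≤ (1 + C₁/2)⁻¹ I N` by Lebesgue's theorem
for monotone functions (`mul_volume_mul_le_sub_of_deriv_le`), the second eventually gives
`I (N+1) ≤ ½ I N` (`exists_forall_le_half_of_le_rpow`), and a geometric step of the integer
samples of an antitone function is exponential decay (`exists_exp_bound_of_succ_le_mul`).
[cite: DeMichelisFreedman1992, App. B, (B.8)–(B.9) (p. 253)] -/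
theorem deMichelisFreedman1992_appendixB_exp_decay {I I' : ℝ → ℝ} (hI : Antitone I)
    (hI0 : ∀ t, 0 ≤ I t)
    {Δ : Set ℝ} (hΔm : MeasurableSet Δ)
    (hΔ : ∀ N : ℕ, volume (Δ ∩ Icc (N : ℝ) (N + 1)) ≤ 2⁻¹)
    {C₁ C₄ p : ℝ} (hC₁ : 0 < C₁) (hp : 1 < p) {N₀ : ℕ}
    (halt : ∀ N : ℕ, N₀ ≤ N →
      (∀ t ∈ Ico (N : ℝ) (N + 1) \ Δ, HasDerivAt I (I' t) t ∧ I' t ≤ -(C₁ * I t)) ∨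
      I (N + 1) ≤ C₄ * (I N - I (N + 1)) ^ p) :
    ∃ C₅ δ : ℝ, 0 < δ ∧ 0 ≤ C₅ ∧ ∀ t, 0 ≤ t → I t ≤ C₅ * Real.exp (-(δ * t)) := by
  -- the integer samples
  have ha : Antitone fun n : ℕ => I n := fun m n hmn => hI (by exact_mod_cast hmn)
  have ha0 : ∀ n : ℕ, 0 ≤ I n := fun n => hI0 n
  obtain ⟨N₁, hN₁⟩ := exists_forall_le_half_of_le_rpow (C := C₄) ha ha0 hp
  -- the common ratio
  set θ : ℝ := max 2⁻¹ (1 + C₁ * 2⁻¹)⁻¹ with hθ_def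
  have hq : 1 < 1 + C₁ * 2⁻¹ := by linarith
  have hθ0 : 0 < θ := lt_max_iff.2 (Or.inl (by norm_num))
  have hθ1 : θ < 1 := max_lt (by norm_num) (inv_lt_one_of_one_lt₀ hq)
  refine exists_exp_bound_of_succ_le_mul hI hI0 hθ0 hθ1 (M := max N₀ N₁) fun n hn => ?_
  rcases halt n (le_of_max_le_left hn) with h | h
  · -- alternative 1 on `[n, n+1) ∖ Δ`
    have hS := half_le_toReal_volume_Ico_diff n (hΔ n)
    have key := mul_volume_mul_le_sub_of_deriv_le (I := I) (I' := I') (a := (n : ℝ))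
      (b := n + 1) (by linarith) hC₁.le (measurableSet_Ico.diff hΔm)
      (sdiff_subset.trans Ico_subset_Icc_self)
      (hI.antitoneOn _) (hI0 _) (fun t ht => (h t ht).1) (fun t ht => (h t ht).2)
    have h1 : (1 + C₁ * 2⁻¹) * I (n + 1) ≤ I n := by
      have : C₁ * 2⁻¹ * I (n + 1) ≤ C₁ * (volume (Ico (n : ℝ) (n + 1) \ Δ)).toReal * I (n + 1) :=
        mul_le_mul_of_nonneg_right (mul_le_mul_of_nonneg_left hS hC₁.le) (hI0 _)
      linarith
    calc I (n + 1) ≤ (1 + C₁ * 2⁻¹)⁻¹ * I n := (le_inv_mul_iff₀ (by linarith)).2 h1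
      _ ≤ θ * I n := mul_le_mul_of_nonneg_right (le_max_right _ _) (hI0 _)
  · -- alternative 2
    have h2 := hN₁ n (le_of_max_le_right hn) (by simpa only [Nat.cast_add, Nat.cast_one] using h)
    simp only [Nat.cast_add, Nat.cast_one] at h2
    calc I (n + 1) ≤ 2⁻¹ * I n := h2
      _ ≤ θ * I n := mul_le_mul_of_nonneg_right (le_max_left _ _) (hI0 _)


/-- **The same with the alternatives given pointwise on `ℝ₊ ∖ Δ`**, as the source phrases it
("any combination of these two alternatives on `ℝ₊ ∖ Δ`"): at each `t ≥ N₀` off `Δ`, either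
`I` is differentiable at `t` with `I' t ≤ -C₁ I t`, or the integer interval `[N, N+1] ∋ t`,
`N = ⌊t⌋`, satisfies `I (N+1) ≤ C₄ (I N - I (N+1))^p`.
[cite: DeMichelisFreedman1992, App. B, (B.8)–(B.9) (p. 253)] -/
theorem deMichelisFreedman1992_appendixB_exp_decay_pointwise {I I' : ℝ → ℝ} (hI : Antitone I)
    (hI0 : ∀ t, 0 ≤ I t) {Δ : Set ℝ} (hΔm : MeasurableSet Δ)
    (hΔ : ∀ N : ℕ, volume (Δ ∩ Icc (N : ℝ) (N + 1)) ≤ 2⁻¹)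
    {C₁ C₄ p : ℝ} (hC₁ : 0 < C₁) (hp : 1 < p) {N₀ : ℕ}
    (halt : ∀ t : ℝ, (N₀ : ℝ) ≤ t → t ∉ Δ →
      (HasDerivAt I (I' t) t ∧ I' t ≤ -(C₁ * I t)) ∨
      I (⌊t⌋₊ + 1) ≤ C₄ * (I ⌊t⌋₊ - I (⌊t⌋₊ + 1)) ^ p) :
    ∃ C₅ δ : ℝ, 0 < δ ∧ 0 ≤ C₅ ∧ ∀ t, 0 ≤ t → I t ≤ C₅ * Real.exp (-(δ * t)) := by
  refine deMichelisFreedman1992_appendixB_exp_decay (I' := I') hI hI0 hΔm hΔ hC₁ hp (C₄ := C₄)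
    (N₀ := N₀) fun N hN => ?_
  by_cases h2 : I (N + 1) ≤ C₄ * (I N - I (N + 1)) ^ p
  · exact Or.inr h2
  · refine Or.inl fun t ht => ?_
    have htN : ⌊t⌋₊ = N := by
      rw [Nat.floor_eq_iff ((Nat.cast_nonneg N).trans ht.1.1)]
      exact ⟨ht.1.1, ht.1.2⟩
    have hN₀t : (N₀ : ℝ) ≤ t := le_trans (by exact_mod_cast hN) ht.1.1
    rcases halt t hN₀t ht.2 with h | h
    · exact h
    · exact absurd (by simpa only [htN] using h) h2

end Literature.Barriers.SmoothPoincare4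

end
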